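import Summits.AtomisticToContinuum.HydrodynamicLimit.Theorems.CollisionIsometryCLTMacroClosureStubThermoCoercive
import Summits.AtomisticToContinuum.HydrodynamicLimit.Theorems.CollisionIsometryCLTMacroClosureStubThermoCompat
import Summits.AtomisticToContinuum.HydrodynamicLimit.Theses.StiffCollisionalRelaxation

/-!
# Stub `stub_thermo` of the line `IdeatorTwoGen1Sketch` (crux `MacroClosure`, stmt-14870) —
# assembly: `∃ η₃ > 0, ThermoChamber η₃`

Proof file (`--supports stmt-AtomisticToContinuum-14870`) for the registered stub
`Barycentric.stub_thermo : ∃ η₃ : ℝ, 0 < η₃ ∧ ThermoChamber η₃` of the skeleton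
`Cruxes/MacroClosure/Lines/IdeatorTwoGen1Sketch.lean`, UNCONDITIONALLY — in particular without the
open convexity item `StiffCollisionalRelaxation.HsFreeEnergyConvex` (stmt-9526), so the registered
conditional fallback `stub_thermo_of_hsFreeEnergyConvex` follows trivially.

With the `HsEosLowDensity` witness `(η₀, F)` (`eos_data`, from the proved `hsEosLowDensity_proof`):
* clause 1 (smoothness of `η_σ` and of the fluxes on the chamber) is `stub_thermo_clause1`
  (part 1, `…StubThermoEos`);
* clause 2 (two-regime coercivity of `h_σ(V | U)` on the band) is `stub_thermo_clause2`
  (parts 2a–2b, `…StubThermoIdeal`, `…StubThermoCoercive`), at any level `≤ η₂(η₀, F) ≤ η₀`;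
* clause 3 (smoothness, explicit form, entropy/entropy-flux compatibility and vanishing total
  entropy flux of `Λ = Dη_σ(U_cl)`) is `stub_thermo_compat` (parts 3a–3c, `…StubThermoLambda`,
  `…StubThermoFlux`, `…StubThermoCompat`), at any level `≤ η₀`.
The dilute level of the stub is `η₃ := η₂(η₀, F)`.
-/

noncomputable section

open MeasureTheory Filter Set Topology InformationTheory
open scoped ENNReal ContDiff

namespace Summit.AtomisticToContinuum.HydrodynamicLimit.Theorems.MacroClosureLine

open Literature.MathematicalPhysics.KineticTheory Literature.Analysis.FluidPDE
open Literature.Analysis.FunctionSpaces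
open Summit.AtomisticToContinuum.HydrodynamicLimit.Theses

namespace Barycentric

/-- **`stub_thermo` (registered stub of the line `IdeatorTwoGen1Sketch`): there is a dilute level
`η₃ > 0` at which `ThermoChamber η₃` holds** — for every `σ > 0`: the entropy `η_σ` and the hs-Euler
fluxes are smooth on the chamber `{0 < ρ, ρσ³ < η₃, |m|² < 2ρE}`; the relative entropy density
`h_σ(V | U)` is bounded below by `m·min(‖V − U‖², ‖V − U‖)` on the band, uniformly for `U` in compact
parts of the chamber; and along every classical hs-Euler solution staying in the chamber the
entropy-variable field `Λ = Dη_σ(U_cl)` is jointly smooth, has the explicit form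
`Λ V = λ⁰ V.1 + ⟪θ⁻¹u, V.2.1⟫ − θ⁻¹ V.2.2`, satisfies `∂ₛΛ·V + Σⱼ ∂ⱼΛ·DFⱼ(U_cl)V = 0` and
`∫ Σⱼ ∂ⱼΛ·Fⱼ(U_cl) = 0`. -/
theorem stub_thermo : ∃ η₃ : ℝ, 0 < η₃ ∧ ThermoChamber η₃ := by
  obtain ⟨η₀, hη₀, F, hFa, hF, hF0, -⟩ := eos_data
  obtain ⟨η₂, hη₂, hη₂₀, h2⟩ := stub_thermo_clause2 η₀ F hη₀ hFa hF hF0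
  refine ⟨η₂, hη₂, fun σ hσ => ⟨stub_thermo_clause1 η₀ F hFa hF σ η₂ hσ hη₂₀, h2 σ η₂ hσ le_rfl,
    fun T ρ θ u hE hpack => ?_⟩⟩
  intro U Λ
  exact stub_thermo_compat η₀ F hFa hF σ η₂ hσ hη₂₀ T ρ θ u hE hpack

/-- **`stub_thermo_of_hsFreeEnergyConvex` (registered conditional fallback)**: trivial from the
unconditional `stub_thermo`. -/
theorem stub_thermo_of_hsFreeEnergyConvex :
    StiffCollisionalRelaxation.HsFreeEnergyConvex → ∃ η₃ : ℝ, 0 < η₃ ∧ ThermoChamber η₃ :=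
  fun _ => stub_thermo

end Barycentric

end Summit.AtomisticToContinuum.HydrodynamicLimit.Theorems.MacroClosureLine

end
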